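import Summits.QuantumAdvantage.AdviceFreeQNC0.MassInequalityRegimes
import HarnessLib

/-!
# Cell qa-qnc0 (rung F-Q1, density axis, crux of record `TensorMultOneAt`): the COLUMN TEST, (★) and the
# RELAXED MASS INEQUALITY — `RelMIOfStar m` and `OneWordOfRelMI m` for every `m`
# (planner qa-qnc0-p1 gen 14, Sketch14 §ColumnTest, ask P19)

Planner qa-qnc0-p1 ROUND-13 §1 (`HOME/qa-qnc0-p1/ROUND-13.md`, `Sketch14.lean`).  Statements VERBATIM from
Sketch14 §ColumnTest: `bq`, `inCount`, `outCount`, `ColTest`, `StarCert` ((★)), `freq`, `RelMassIneqAt` (R-MI),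
`RelMIOfStar`, `OneWordOfRelMI`.  PROVED here:

* **`relMIOfStar : ∀ m, RelMIOfStar m`** — (★) ⇒ R-MI by weak duality: for a weight `μ` on codewords let `s`
  be the outside majority word (`s u ⇔ 2 p_u > M`), take the fractional inside completion `q` from (★);
  inside, `min(p_z, M − p_z) ≤ (1 − q_z) p_z + q_z (M − p_z) = Σ_X μ(X) |X z − q z|`; swap the sums, apply the
  column test to every codeword in the support, and `Σ_X μ(X) #{u ∉ Z : X u ≠ s u} = Σ_{u ∉ Z} min(p_u, M − p_u)`.
* **`oneWordOfRelMI : ∀ m, OneWordOfRelMI m`** — R-MI ⇒ ONE-WORD MI: for `D` with codeword columns supported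
  on the columns of a minimum word `c`, the column-count weight `μ X = #{v ∈ supp c : D(·)(v) = X}` has
  `M = pwt c`, `freq μ u = pwt (D u)`, and `min (pwt (D u)) (pwt c − pwt (D u)) = distC m (D u)` by
  `OneWordDecode` (qn-lit's `oneWordDecode`); R-MI is then `0 ≤ bracket m K0 D`.

Hence (planner's chain `oneWordMIEightChain`) ONE-WORD MI at `m = 8` hangs on `OutHeavyEight` (finite) and
`StarOfOutHeavyButOne` (Lemma G′).  The cell's lemmas (not in print).  WHAT THIS IS NOT: (★) at m = 14, 15 is
OPEN; nothing on α; separation NOT moved.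
-/

noncomputable section

namespace Summit.QuantumAdvantage.AdviceFreeQNC0

open Finset
open Literature.Computability.MetaComplexity Literature.Computability.MetaComplexity.Smolensky

namespace MassInequality

/-! ### Sketch14 §ColumnTest — statements VERBATIM -/
section ColumnTest

/-- A Boolean as a rational `0/1`. -/
def bq (b : Bool) : ℚ := if b then 1 else 0

/-- Number of points of the pattern `A` INSIDE `Z(K0) = {K0 = false}`. -/
def inCount {m : ℕ} (K0 A : (Fin m → Bool) → Bool) : ℕ :=
  (univ.filter fun u : Fin m → Bool => A u = true ∧ K0 u = false).card

/-- Number of points of the pattern `A` OUTSIDE `Z(K0)`. -/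
def outCount {m : ℕ} (K0 A : (Fin m → Bool) → Bool) : ℕ :=
  (univ.filter fun u : Fin m → Bool => A u = true ∧ K0 u = true).card

/-- THE COLUMN TEST.  (Sketch14, verbatim.) -/
def ColTest (m : ℕ) (K0 : (Fin m → Bool) → Bool) (q : (Fin m → Bool) → ℚ) (s : (Fin m → Bool) → Bool) : Prop :=
  (∀ z, K0 z = false → 0 ≤ q z ∧ q z ≤ 1) ∧
  ∀ X, IsElim1 m X →
    (∑ z ∈ univ.filter (fun z : Fin m → Bool => K0 z = false), |bq (X z) - q z|) ≤
      ((univ.filter fun u : Fin m → Bool => K0 u = true ∧ X u ≠ s u).card : ℚ)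

/-- **(★)(m, K0)**: EVERY outside word admits a fractional inside completion passing the column test.
(Sketch14, verbatim.) -/
def StarCert (m : ℕ) (K0 : (Fin m → Bool) → Bool) : Prop :=
  ∀ s : (Fin m → Bool) → Bool, ∃ q : (Fin m → Bool) → ℚ, ColTest m K0 q s

/-- Column frequency `p_u = Σ_X μ(X)·X(u)` of a weight `μ` on patterns.  (Sketch14, verbatim.) -/
def freq {m : ℕ} (μ : ((Fin m → Bool) → Bool) → ℚ) (u : Fin m → Bool) : ℚ := ∑ X, μ X * bq (X u)

/-- **R-MI(m) at `K0`** — the RELAXED mass inequality.  (Sketch14, verbatim.) -/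
def RelMassIneqAt (m : ℕ) (K0 : (Fin m → Bool) → Bool) : Prop :=
  ∀ μ : ((Fin m → Bool) → Bool) → ℚ, (∀ X, 0 ≤ μ X) → (∀ X, μ X ≠ 0 → IsElim1 m X) →
    (∑ z ∈ univ.filter (fun z : Fin m → Bool => K0 z = false), min (freq μ z) ((∑ X, μ X) - freq μ z)) ≤
      ∑ u ∈ univ.filter (fun u : Fin m → Bool => K0 u = true), min (freq μ u) ((∑ X, μ X) - freq μ u)

/-- (★) ⇒ R-MI (weak duality).  (Sketch14, verbatim; proved below.) -/
def RelMIOfStar (m : ℕ) : Prop := ∀ K0 : (Fin m → Bool) → Bool, StarCert m K0 → RelMassIneqAt m K0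

/-- R-MI ⇒ ONE-WORD MI.  (Sketch14, verbatim; proved below.) -/
def OneWordOfRelMI (m : ℕ) : Prop :=
  ∀ K0 : (Fin m → Bool) → Bool, OneWordDecode m → RelMassIneqAt m K0 → OneWordMIAt m K0

end ColumnTest

end MassInequality

open MassInequality

namespace ColTestProofs

variable {m : ℕ}

/-- `bq` takes values in `[0,1]`: `bq b = 1 - bq (!b)`. -/
theorem bq_cases (b : Bool) : (b = true ∧ bq b = 1) ∨ (b = false ∧ bq b = 0) := by
  cases b <;> simp [bq]

/-- `|bq b − q| = (1 − q)·bq b + q·(1 − bq b)` for `q ∈ [0,1]`. -/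
theorem abs_bq_sub (b : Bool) {q : ℚ} (h0 : 0 ≤ q) (h1 : q ≤ 1) :
    |bq b - q| = (1 - q) * bq b + q * (1 - bq b) := by
  cases b
  · simp only [bq]; rw [if_neg Bool.false_ne_true, zero_sub, abs_neg, abs_of_nonneg h0]; ring
  · simp only [bq, if_true]; rw [abs_of_nonneg (by linarith)]; ring

/-- The minimum is below every convex combination. -/
theorem min_le_convex {a b q : ℚ} (h0 : 0 ≤ q) (h1 : q ≤ 1) : min a b ≤ (1 - q) * a + q * b := by
  rcases le_total a b with h | h
  · rw [min_eq_left h]; nlinarith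
  · rw [min_eq_right h]; nlinarith

end ColTestProofs

open ColTestProofs

/-- **`RelMIOfStar m` for every `m` — PROVED** ((★) ⇒ R-MI, weak duality). -/
theorem relMIOfStar (m : ℕ) : RelMIOfStar m := by
  classical
  intro K0 hstar μ hμ0 hμC
  set M : ℚ := ∑ X, μ X with hM
  -- the outside majority word and its certificate
  set s : (Fin m → Bool) → Bool := fun u => decide (M < 2 * freq μ u) with hs
  obtain ⟨q, hq01, htest⟩ := hstar s
  -- `M − p_u = Σ_X μ X (1 − bq (X u))`
  have hMp : ∀ u, M - freq μ u = ∑ X, μ X * (1 - bq (X u)) := by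
    intro u; unfold freq; rw [hM, ← sum_sub_distrib]
    exact sum_congr rfl fun X _ => by ring
  -- inside: min ≤ Σ_X μ X |bq (X z) − q z|
  have hin : ∀ z, K0 z = false → min (freq μ z) (M - freq μ z) ≤ ∑ X, μ X * |bq (X z) - q z| := by
    intro z hz
    obtain ⟨h0, h1⟩ := hq01 z hz
    calc min (freq μ z) (M - freq μ z) ≤ (1 - q z) * freq μ z + q z * (M - freq μ z) := min_le_convex h0 h1
      _ = ∑ X, μ X * |bq (X z) - q z| := by
          rw [hMp]; unfold freq; rw [mul_sum, mul_sum, ← sum_add_distrib]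
          refine sum_congr rfl fun X _ => ?_
          rw [abs_bq_sub (X z) h0 h1]; ring
  -- outside: Σ_X μ X [X u ≠ s u] = min(p_u, M − p_u)
  have hout : ∀ u, (∑ X, μ X * (if X u ≠ s u then (1 : ℚ) else 0)) = min (freq μ u) (M - freq μ u) := by
    intro u
    by_cases hsu : s u = true
    · -- majority `true`: mismatches are the `false` entries, total `M − p_u`, and `M − p_u < p_u`
      have hlt : M < 2 * freq μ u := by simpa [hs] using hsu
      rw [min_eq_right (by linarith), hMp]
      refine sum_congr rfl fun X _ => ?_
      rw [hsu]; cases X u <;> simp [bq]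
    · have hle : ¬ M < 2 * freq μ u := by simpa [hs] using hsu
      rw [min_eq_left (by linarith)]
      unfold freq
      refine sum_congr rfl fun X _ => ?_
      rw [Bool.not_eq_true] at hsu
      rw [hsu]; cases X u <;> simp [bq]
  calc (∑ z ∈ univ.filter (fun z : Fin m → Bool => K0 z = false), min (freq μ z) (M - freq μ z))
      ≤ ∑ z ∈ univ.filter (fun z : Fin m → Bool => K0 z = false), ∑ X, μ X * |bq (X z) - q z| :=
        sum_le_sum fun z hz => hin z (mem_filter.1 hz).2
    _ = ∑ X, μ X * ∑ z ∈ univ.filter (fun z : Fin m → Bool => K0 z = false), |bq (X z) - q z| := by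
        rw [Finset.sum_comm]; exact sum_congr rfl fun X _ => by rw [mul_sum]
    _ ≤ ∑ X, μ X * ((univ.filter fun u : Fin m → Bool => K0 u = true ∧ X u ≠ s u).card : ℚ) := by
        refine sum_le_sum fun X _ => ?_
        by_cases hX : μ X = 0
        · rw [hX, zero_mul, zero_mul]
        · exact mul_le_mul_of_nonneg_left (htest X (hμC X hX)) (hμ0 X)
    _ = ∑ X, μ X * ∑ u ∈ univ.filter (fun u : Fin m → Bool => K0 u = true),
          (if X u ≠ s u then (1 : ℚ) else 0) := by
        refine sum_congr rfl fun X _ => ?_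
        congr 1
        rw [Finset.card_filter, Nat.cast_sum, Finset.sum_filter]
        refine sum_congr rfl fun u _ => ?_
        by_cases h1 : K0 u = true <;> by_cases h2 : X u ≠ s u <;> simp [h1, h2]
    _ = ∑ u ∈ univ.filter (fun u : Fin m → Bool => K0 u = true),
          ∑ X, μ X * (if X u ≠ s u then (1 : ℚ) else 0) := by
        rw [Finset.sum_comm]; exact sum_congr rfl fun X _ => by rw [mul_sum]
    _ = ∑ u ∈ univ.filter (fun u : Fin m → Bool => K0 u = true), min (freq μ u) (M - freq μ u) :=
        sum_congr rfl fun u _ => hout u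

/-- **`OneWordOfRelMI m` for every `m` — PROVED** (R-MI ⇒ ONE-WORD MI via the column-count weight). -/
theorem oneWordOfRelMI (m : ℕ) : OneWordOfRelMI m := by
  classical
  intro K0 hdec hrel c hc D hcols hsupp
  -- the column-count weight on codewords
  set F : Finset (Fin m → Bool) := univ.filter fun v : Fin m → Bool => c v = true with hF
  set μ : ((Fin m → Bool) → Bool) → ℚ := fun X => ((F.filter fun v => (fun u => D u v) = X).card : ℚ) with hμ
  have hμ0 : ∀ X, 0 ≤ μ X := fun X => by simp only [hμ]; exact Nat.cast_nonneg _
  have hμC : ∀ X, μ X ≠ 0 → IsElim1 m X := by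
    intro X hX
    have hne : (F.filter fun v => (fun u => D u v) = X).Nonempty := by
      rw [← card_pos]
      have : ((F.filter fun v => (fun u => D u v) = X).card : ℚ) ≠ 0 := hX
      exact_mod_cast Nat.pos_of_ne_zero fun h => this (by rw [h]; rfl)
    obtain ⟨v, hv⟩ := hne
    rw [← (mem_filter.1 hv).2]; exact hcols v
  -- fibrewise sums: `Σ_X μ X · g X = Σ_{v ∈ F} g (D(·)(v))`
  have hfib : ∀ g : ((Fin m → Bool) → Bool) → ℚ, ∑ X, μ X * g X = ∑ v ∈ F, g (fun u => D u v) := by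
    intro g
    have h1 : ∀ X, μ X * g X = ∑ v ∈ F.filter (fun v => (fun u => D u v) = X), g (fun u => D u v) := by
      intro X
      rw [sum_congr rfl fun v hv => by rw [(mem_filter.1 hv).2], sum_const, nsmul_eq_mul]
    simp_rw [h1]
    exact sum_fiberwise_of_maps_to (fun v _ => mem_univ _) _
  have hM : (∑ X, μ X) = (pwt c : ℚ) := by
    have h := hfib fun _ => 1
    simp only [mul_one, sum_const, nsmul_eq_mul] at h
    rw [h]; simp [hF, pwt]
  have hfreq : ∀ u, freq μ u = (pwt (D u) : ℚ) := by
    intro u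
    unfold freq
    rw [hfib fun X => bq (X u)]
    simp only [bq]
    rw [Finset.sum_ite, sum_const_zero, add_zero, sum_const, nsmul_eq_mul, mul_one]
    unfold pwt
    congr 2
    ext v
    simp only [hF, mem_filter, mem_univ, true_and]
    constructor
    · rintro ⟨_, h⟩; exact h
    · intro h
      refine ⟨?_, h⟩
      by_contra hcv
      rw [Bool.not_eq_true] at hcv
      rw [hsupp u v hcv] at h
      exact Bool.false_ne_true h
  -- apply R-MI and one-word decoding
  have hR := hrel μ hμ0 hμC
  simp only [hfreq, hM] at hR
  have hdist : ∀ u, (distC m (D u) : ℚ) = min (pwt (D u) : ℚ) ((pwt c : ℚ) - pwt (D u)) := by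
    intro u
    have h := hdec c hc (D u) (fun v hv => hsupp u v hv)
    have hle : pwt (D u) ≤ pwt c := by
      unfold pwt
      refine card_le_card fun v hv => ?_
      simp only [mem_filter, mem_univ, true_and] at hv ⊢
      by_contra hcv
      rw [Bool.not_eq_true] at hcv
      rw [hsupp u v hcv] at hv
      exact Bool.false_ne_true hv
    rw [h, Nat.cast_min, Nat.cast_sub hle]
  unfold bracket
  have key : (∑ u ∈ univ.filter (fun u : Fin m → Bool => K0 u = false), (distC m (D u) : ℚ)) ≤
      ∑ u ∈ univ.filter (fun u : Fin m → Bool => K0 u = true), (distC m (D u) : ℚ) := by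
    simp only [hdist]; exact hR
  have key' : (∑ u ∈ univ.filter (fun u : Fin m → Bool => K0 u = false), distC m (D u)) ≤
      ∑ u ∈ univ.filter (fun u : Fin m → Bool => K0 u = true), distC m (D u) := by exact_mod_cast key
  have key'' : ((∑ u ∈ univ.filter (fun u : Fin m → Bool => K0 u = false), distC m (D u) : ℕ) : ℤ) ≤
      ((∑ u ∈ univ.filter (fun u : Fin m → Bool => K0 u = true), distC m (D u) : ℕ) : ℤ) := by
    exact_mod_cast key'
  push_cast at key''
  linarith

end Summit.QuantumAdvantage.AdviceFreeQNC0
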